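import Summits.CriticalPhenomena.PercolationContinuityZ3.Theorems.PercNearOneGluingNoHeavyQuantFarGate3Cell99RuleA
import Summits.CriticalPhenomena.PercolationContinuityZ3.Theorems.PercNearOneGluingNoHeavyQuantFarGate3Cell99RuleB
import Summits.CriticalPhenomena.PercolationContinuityZ3.Theorems.PercNearOneGluingNoHeavyQuantFarGate3Cell99RuleD
import Summits.CriticalPhenomena.PercolationContinuityZ3.Theorems.PercNearOneGluingNoHeavyQuantFarGate3ChartD
import Summits.CriticalPhenomena.PercolationContinuityZ3.Theorems.PercNearOneGluingNoHeavyQuantFarGate3Reduce8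

/-!
# QUANT lane R8, front "FAR beyond trees", layer one — THE DEGREE-THREE GATE AT THE OBSERVER, LXXV: the CELL (9,9) `r₁, r₂ ∈ [9/10, 1)` below
# `p = 1/20` — the corner line is closed (all `nn ≥ 1`, no condition on `nn·p`)

builds on p205010 (kernel theorem, internal audit signed; external expert review pending)

Support file (`--supports stmt-CriticalPhenomena-4575`), seat `prim-quant-p1` (gen 37); memo
`run/shared/lean/prim/quant/prim-quant-p1-g37/FOR-LEAD-GATE3-CORNERLINE.md`.  Mathlib-only on top of files LXXIVa–d, LXXVa–d (regimes, certificates,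
rules), LV (`red8_of_chartD`) and XXX (`red8_symm`); standard axioms; no sorries; no definitions.  GENERATED by `work/gen_cover.py` (p1 g37).

THE POINT (files LXXIV–LXXV).  The four closed-form regimes `chartD_cp / chartD_a / chartD_b / chartD_d` (files LXXIVa–d) cover the whole
cell `r₁, r₂ ∈ [9/10, 1)`, `nn·p < 5/8`, `0 < p < 1/20`, `nn ≥ 1` of the degree-three gate: in chart-D variables (`σ = nn·p`, `u = 1/nn`,
`ε = 1 − r₁`, `θ = (1−r₂)/(1−r₁)`, `η = ε(1+θ)`) the decision rule is  `Δ' ≤ σu·c₀'` → c′;  else `η ≤ 2σ` → a;  else `u ≥ 3/20` → d;  else → b.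
After eliminating `t = η/σ` (regime a is monotone in the bound parameter `Ψ`, which is affine in `t ≤ 2`), `σ < η/2` (regimes b, d) and
`κ = σu` (per-occurrence worst case, `κ ≤ 1/20` resp. `κ ≤ ηu/2`), each rule reduces to one or two polynomial inequalities in TWO variables
(`(ε, θε)` for a, `(u, η)` for b and d) of bidegree ≤ (7,6), certified here by tensor-Bernstein coefficients (all non-negative on ONE box each;
`ring` + `linarith`).  Numerics and derivation: memo §2–§4 (`num/regimes.py`, `num/final2d.py`, `num/e2e.py`: exact end-to-end check of the
kernel hypotheses at > 10⁵ rational cell points).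

`Gate3.chartD_cell99`: the chart-D system is infeasible for every `σ > 0`, `0 < u ≤ 1`, `σu ≤ 1/20`, `0 < ε ≤ 1/10`, `0 < θ ≤ 1` (three
cases: `η ≤ 2σ` → rule A; else `u ≤ 3/20` → rule B; else rule D — the coupled-plus regime `chartD_cp` is contained in rule A).
`Gate3.red8_cell99_of_le` / `red8_cell99`: the 8-cell statement for `0 < p < 1/20`, `nn ≥ 1`, `r₁, r₂ ∈ [9/10, 1)` — the last open patch
of the gate below `p = 1/20` (g34 memo §5, g36 memo §6); note that no hypothesis on `nn·p` is needed.  [this work].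
-/

noncomputable section

namespace Summit.CriticalPhenomena.PercolationContinuityZ3.Theorems

namespace Quant

namespace Gate3


/-- **The chart-D system is infeasible on the whole (9,9) cell** (`σ > 0`, `0 < u ≤ 1`, `σu ≤ 1/20`, `0 < ε ≤ 1/10`, `0 < θ ≤ 1`). [this work] -/
theorem chartD_cell99 (σ u ε θ : ℝ) (hσ : 0 < σ) (hu : 0 < u) (hu1 : u ≤ 1) (hκ : σ * u ≤ 1 / 20) (hε : 0 < ε) (hε1 : ε ≤ 1 / 10)
    (hθ : 0 < θ) (hθ1 : θ ≤ 1) :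
    ∀ (a0 a1 At B1 B2 c0 c1 D : ℝ), 0 ≤ a0 → 0 ≤ a1 → 0 ≤ At → 0 ≤ B1 → 0 ≤ B2 → 0 ≤ c0 → 0 ≤ c1 → 0 ≤ D →
      0 ≤ (σ * D * (a0 + a1 + σ * u * (ε * θ * At)) - B1 * (u * B2 + (c0 + c1))) →
      0 ≤ (σ * D * (a0 + a1 + σ * u * (ε * θ * At)) - B2 * (u * B1 + (c0 + c1))) →
      0 ≤ (σ * D * (a0 + a1 + σ * u * (ε * θ * At)) - (c0 + c1) * (B1 + B2)) →
      0 ≤ (σ * D * (a0 + u * B1 + u * B2 + c0) - B1 * (a1 + σ * u * (ε * θ * At) + c1 + σ * u * D)) →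
      0 ≤ (σ * D * (a0 + u * B1 + u * B2 + c0) - B2 * (a1 + σ * u * (ε * θ * At) + c1 + σ * u * D)) →
      0 ≤ ((c1 + σ * u * D) * (a0 + u * B1 + u * B2 + c0) - c0 * (a1 + σ * u * (ε * θ * At) + c1 + σ * u * D)) →
      0 < ε * a0 + (-(1 - σ * u)) * At + ε * c0 + (-((1 - σ * u) * ε)) * D →
      0 < (-(σ * (1 - θ * ε))) * a0 + (-σ) * a1 + (-(σ * θ * (1 - σ * u * (1 - ε)))) * At + (1 - σ * u) * B1 + (-(1 - (1 - σ * u) * (θ * ε))) * B2 + (-(σ * ε * θ)) * c1 →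
      0 < (-(σ * (1 - ε))) * a0 + (-σ) * a1 + (-(σ * (1 - σ * u * (1 - θ * ε)))) * At + (-(1 - (1 - σ * u) * ε)) * B1 + (1 - σ * u) * B2 + (-(σ * ε)) * c1 →
      0 < (-(σ * (1 - ε) * (θ * ε))) * a0 + (1 - σ * u * (1 - θ * ε) - σ * θ * ε) * a1 + (-((σ * u + (1 - σ * u) * (1 - ε)) * (θ * ε))) * B1 + (-((σ * u + (1 - σ * u) * (1 - θ * ε)) * ε)) * B2 + (1 - σ * u * (1 - ε * ε * θ) - σ * (ε * ε * θ)) * c1 →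
      0 < (σ * u * (3 - ε - θ * ε) + σ * (1 - θ * ε) - 2) * a0 + (σ * u * (2 - ε) + σ * (1 - θ * ε) - 1) * a1 + (ε * θ * (σ * (σ * u * u * (3 - ε - θ * ε) + 1 - 2 * u))) * At + ((σ * u + (1 - σ * u) * (1 - ε)) * (1 - θ * ε) * (1 + u) - (1 - σ * u) * ε * u) * B1 + ((σ * u + (1 - σ * u) * (1 - θ * ε)) * (1 - ε) * (1 + u) - (1 - σ * u) * (θ * ε) * u) * B2 + (σ * u + (σ + 2 * (σ * u)) * (1 - ε * ε * θ) - 2) * c0 + (σ * u + (σ + σ * u) * (1 - ε * ε * θ) - 1) * c1 + (σ + σ * u - σ * u * ((1 - σ * u) * (ε * ε * θ))) * D →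
      False := by
  by_cases ht : ε * (1 + θ) ≤ 2 * σ
  · exact chartD_rule_a σ u ε θ hσ hu hκ hε hε1 hθ hθ1 ht
  · push Not at ht
    by_cases hu3 : u ≤ 3 / 20
    · exact chartD_rule_b σ u ε θ hσ hu hu3 hε hε1 hθ hθ1 ht.le
    · push Not at hu3
      exact chartD_rule_d σ u ε θ hσ hu3.le hu1 hκ hε hε1 hθ hθ1 ht.le

/-- **Cell (9,9) of the degree-three gate, ordered version**: `0 < p < 1/20`, `nn ≥ 1`, `9/10 ≤ r₁ ≤ r₂ < 1`. [this work] -/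
theorem red8_cell99_of_le (p r₁ r₂ nn : ℝ) (hp0 : 0 < p) (hp : p < (1 : ℝ) / 20) (h1lo : (9 : ℝ) / 10 ≤ r₁) (h12 : r₁ ≤ r₂) (hr2 : r₂ < 1)
    (hn : 1 ≤ nn) :
    ∀ (a0 a1 a2 b1 b2 c0 c1 d : ℝ), 0 ≤ a0 → 0 ≤ a1 → 0 ≤ a2 → 0 ≤ b1 → 0 ≤ b2 → 0 ≤ c0 → 0 ≤ c1 → 0 ≤ d →
    b1 * (b2 + (c0 + c1)) ≤ (a0 + a1 + a2) * d →
    b2 * (b1 + (c0 + c1)) ≤ (a0 + a1 + a2) * d →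
    (c0 + c1) * (b1 + b2) ≤ (a0 + a1 + a2) * d →
    b1 * (a1 + a2 + c1 + d) ≤ d * (a0 + b1 + b2 + c0) →
    b2 * (a1 + a2 + c1 + d) ≤ d * (a0 + b1 + b2 + c0) →
    c0 * (a1 + a2 + c1 + d) ≤ (c1 + d) * (a0 + b1 + b2 + c0) →
    0 < p * ((1 - r₁) * (1 - r₂)) * (a0 + c0) - (1 - p) * a2 - (1 - p) * ((1 - r₁) * (1 - r₂)) * d →
    0 < (1 - p) * (1 - r₁) * b1 - p * (r₂ * (1 - r₁)) * a0 - p * (1 - r₁) * a1 - (1 - p * r₁) * a2 - (1 - (1 - p) * (1 - r₂)) * (1 - r₁) * b2 - p * ((1 - r₁) * (1 - r₂)) * c1 →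
    0 < (1 - p) * (1 - r₂) * b2 - p * (r₁ * (1 - r₂)) * a0 - p * (1 - r₂) * a1 - (1 - p * r₂) * a2 - (1 - (1 - p) * (1 - r₁)) * (1 - r₂) * b1 - p * ((1 - r₁) * (1 - r₂)) * c1 →
    0 < (1 - p * max r₁ r₂ - nn * p * (1 - max r₁ r₂)) * a1 + (1 - p * (r₁ + r₂ * (1 - r₁)) - nn * p * ((1 - r₁) * (1 - r₂))) * c1 - nn * p * (r₁ + r₂ * (1 - r₁) - max r₁ r₂) * a0 - nn * ((1 - (1 - p) * (1 - r₁)) * (1 - r₂)) * b1 - nn * ((1 - (1 - p) * (1 - r₂)) * (1 - r₁)) * b2 →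
    0 < (p * (1 + r₁ + r₂ + nn * max r₁ r₂) - 2) * a0 + (p * (1 + r₁ + r₂) + p * max r₁ r₂ * (nn - 1) - 1) * a1 + (p * (1 + r₁ + r₂) + nn - 2) * a2 + ((1 - (1 - p) * (1 - r₁)) * (1 + r₂ * (nn + 1)) - 1) * b1 + ((1 - (1 - p) * (1 - r₂)) * (1 + r₁ * (nn + 1)) - 1) * b2 + (p * (1 + (nn + 2) * (r₁ + r₂ * (1 - r₁))) - 2) * c0 + (p * (1 + (nn + 1) * (r₁ + r₂ * (1 - r₁))) - 1) * c1 + (nn + 1 - (1 - p) * ((1 - r₁) * (1 - r₂))) * d →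
    False := by
  have hn0 : 0 < nn := by linarith
  have hr1 : r₁ < 1 := lt_of_le_of_lt h12 hr2
  refine red8_of_chartD p r₁ r₂ nn (nn * p) (1 / nn) (1 - r₁) ((1 - r₂) / (1 - r₁)) hp0 hn0 rfl rfl h12 hr2 rfl rfl
    (chartD_cell99 (nn * p) (1 / nn) (1 - r₁) ((1 - r₂) / (1 - r₁)) (by positivity) (by positivity) ?_ ?_ (by linarith) (by linarith) ?_ ?_)
  · rw [div_le_iff₀ hn0]; linarith
  · have e : nn * p * (1 / nn) = p := by field_simp
    rw [e]; exact hp.le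
  · exact div_pos (by linarith) (by linarith)
  · rw [div_le_one (by linarith)]; linarith

/-- **Cell (9,9) of the degree-three gate**: `0 < p < 1/20`, `nn ≥ 1`, `r₁, r₂ ∈ [9/10, 1)` (either order). [this work] -/
theorem red8_cell99 (p r₁ r₂ nn : ℝ) (hp0 : 0 < p) (hp : p < (1 : ℝ) / 20) (h1lo : (9 : ℝ) / 10 ≤ r₁) (hr1 : r₁ < 1) (h2lo : (9 : ℝ) / 10 ≤ r₂)
    (hr2 : r₂ < 1) (hn : 1 ≤ nn) :
    ∀ (a0 a1 a2 b1 b2 c0 c1 d : ℝ), 0 ≤ a0 → 0 ≤ a1 → 0 ≤ a2 → 0 ≤ b1 → 0 ≤ b2 → 0 ≤ c0 → 0 ≤ c1 → 0 ≤ d →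
    b1 * (b2 + (c0 + c1)) ≤ (a0 + a1 + a2) * d →
    b2 * (b1 + (c0 + c1)) ≤ (a0 + a1 + a2) * d →
    (c0 + c1) * (b1 + b2) ≤ (a0 + a1 + a2) * d →
    b1 * (a1 + a2 + c1 + d) ≤ d * (a0 + b1 + b2 + c0) →
    b2 * (a1 + a2 + c1 + d) ≤ d * (a0 + b1 + b2 + c0) →
    c0 * (a1 + a2 + c1 + d) ≤ (c1 + d) * (a0 + b1 + b2 + c0) →
    0 < p * ((1 - r₁) * (1 - r₂)) * (a0 + c0) - (1 - p) * a2 - (1 - p) * ((1 - r₁) * (1 - r₂)) * d →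
    0 < (1 - p) * (1 - r₁) * b1 - p * (r₂ * (1 - r₁)) * a0 - p * (1 - r₁) * a1 - (1 - p * r₁) * a2 - (1 - (1 - p) * (1 - r₂)) * (1 - r₁) * b2 - p * ((1 - r₁) * (1 - r₂)) * c1 →
    0 < (1 - p) * (1 - r₂) * b2 - p * (r₁ * (1 - r₂)) * a0 - p * (1 - r₂) * a1 - (1 - p * r₂) * a2 - (1 - (1 - p) * (1 - r₁)) * (1 - r₂) * b1 - p * ((1 - r₁) * (1 - r₂)) * c1 →
    0 < (1 - p * max r₁ r₂ - nn * p * (1 - max r₁ r₂)) * a1 + (1 - p * (r₁ + r₂ * (1 - r₁)) - nn * p * ((1 - r₁) * (1 - r₂))) * c1 - nn * p * (r₁ + r₂ * (1 - r₁) - max r₁ r₂) * a0 - nn * ((1 - (1 - p) * (1 - r₁)) * (1 - r₂)) * b1 - nn * ((1 - (1 - p) * (1 - r₂)) * (1 - r₁)) * b2 →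
    0 < (p * (1 + r₁ + r₂ + nn * max r₁ r₂) - 2) * a0 + (p * (1 + r₁ + r₂) + p * max r₁ r₂ * (nn - 1) - 1) * a1 + (p * (1 + r₁ + r₂) + nn - 2) * a2 + ((1 - (1 - p) * (1 - r₁)) * (1 + r₂ * (nn + 1)) - 1) * b1 + ((1 - (1 - p) * (1 - r₂)) * (1 + r₁ * (nn + 1)) - 1) * b2 + (p * (1 + (nn + 2) * (r₁ + r₂ * (1 - r₁))) - 2) * c0 + (p * (1 + (nn + 1) * (r₁ + r₂ * (1 - r₁))) - 1) * c1 + (nn + 1 - (1 - p) * ((1 - r₁) * (1 - r₂))) * d →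
    False := by
  rcases le_total r₁ r₂ with h12 | h21
  · exact red8_cell99_of_le p r₁ r₂ nn hp0 hp h1lo h12 hr2 hn
  · exact red8_symm p r₁ r₂ nn (red8_cell99_of_le p r₂ r₁ nn hp0 hp h2lo h21 hr1 hn)

end Gate3

end Quant

end Summit.CriticalPhenomena.PercolationContinuityZ3.Theorems
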